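import Literature.Geometry.DiscreteGeometry.KissingCertComp
import Literature.Geometry.DiscreteGeometry.KissingCertDataA
import Literature.Geometry.DiscreteGeometry.KissingCertDataB
import Literature.Geometry.DiscreteGeometry.KissingCertDataC

/-!
# Certificate for `k(4) < 25`: validation of the Gram expansions of blocks `r_v`, `r_t`

Kernel validation (`chunkOK`, `decide`) that the `permBAC` / `permCBA` images of the expansion of block
`r_u` (`certRuPf*`) are the quadratic forms `zᵀ(LLᵀ)z` of the blocks `r_v`, `r_t` (which share the Gram
factor `certRuL` of `r_u`, with permuted basis monomials `certRvZ`, `certRtZ`).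

The statements are written directly in terms of the raw data of `KissingCertData{A,B,C}`
(decoded by `ofFlat`) and the checker of `KissingCertComp`; they are combined in
`KissingNumberFourProofs`.
-/

namespace Literature.Geometry.DiscreteGeometry

open PolyCert PolyCert.SPoly KissingFourCert

set_option maxHeartbeats 0 in
/-- Block `r_v` (all rows). [folklore] -/
theorem certP_v1 :
    chunkOK (GramBlk.mk certRvZ certRuL) 0 (GramBlk.mk certRvZ certRuL).z.length []
      (permBAC (ofFlat certRuPf0 ++ ofFlat certRuPf1 ++ ofFlat certRuPf2 ++ ofFlat certRuPf3)) = true := by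
  decide +kernel

/-- Block `r_v`, empty chunk. [folklore] -/
theorem certP_v2 :
    chunkOK (GramBlk.mk certRvZ certRuL) (GramBlk.mk certRvZ certRuL).z.length 0
      (permBAC (ofFlat certRuPf0 ++ ofFlat certRuPf1 ++ ofFlat certRuPf2 ++ ofFlat certRuPf3))
      (permBAC (ofFlat certRuPf0 ++ ofFlat certRuPf1 ++ ofFlat certRuPf2 ++ ofFlat certRuPf3)) = true := by
  decide +kernel

/-- Block `r_v`, empty chunk. [folklore] -/
theorem certP_v3 :
    chunkOK (GramBlk.mk certRvZ certRuL) ((GramBlk.mk certRvZ certRuL).z.length + 0)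
      ((GramBlk.mk certRvZ certRuL).z.length - ((GramBlk.mk certRvZ certRuL).z.length + 0))
      (permBAC (ofFlat certRuPf0 ++ ofFlat certRuPf1 ++ ofFlat certRuPf2 ++ ofFlat certRuPf3))
      (permBAC (ofFlat certRuPf0 ++ ofFlat certRuPf1 ++ ofFlat certRuPf2 ++ ofFlat certRuPf3)) = true := by
  decide +kernel

set_option maxHeartbeats 0 in
/-- Block `r_t` (all rows). [folklore] -/
theorem certP_t1 :
    chunkOK (GramBlk.mk certRtZ certRuL) 0 (GramBlk.mk certRtZ certRuL).z.length []
      (permCBA (ofFlat certRuPf0 ++ ofFlat certRuPf1 ++ ofFlat certRuPf2 ++ ofFlat certRuPf3)) = true := by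
  decide +kernel

/-- Block `r_t`, empty chunk. [folklore] -/
theorem certP_t2 :
    chunkOK (GramBlk.mk certRtZ certRuL) (GramBlk.mk certRtZ certRuL).z.length 0
      (permCBA (ofFlat certRuPf0 ++ ofFlat certRuPf1 ++ ofFlat certRuPf2 ++ ofFlat certRuPf3))
      (permCBA (ofFlat certRuPf0 ++ ofFlat certRuPf1 ++ ofFlat certRuPf2 ++ ofFlat certRuPf3)) = true := by
  decide +kernel

/-- Block `r_t`, empty chunk. [folklore] -/
theorem certP_t3 :
    chunkOK (GramBlk.mk certRtZ certRuL) ((GramBlk.mk certRtZ certRuL).z.length + 0)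
      ((GramBlk.mk certRtZ certRuL).z.length - ((GramBlk.mk certRtZ certRuL).z.length + 0))
      (permCBA (ofFlat certRuPf0 ++ ofFlat certRuPf1 ++ ofFlat certRuPf2 ++ ofFlat certRuPf3))
      (permCBA (ofFlat certRuPf0 ++ ofFlat certRuPf1 ++ ofFlat certRuPf2 ++ ofFlat certRuPf3)) = true := by
  decide +kernel

end Literature.Geometry.DiscreteGeometry
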